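import Summits.Ventures.PercRepro.C026Recursion

/-!
# The free step of (Con) at the mark–mark edges at `c`, and the bridge from the censused form
(p5, gen 8)

Mine-3's census of the contraction condition (Con)_e (`proofs/MINE3-Q3-proof.md` §16.3) runs over
the **c–non-mark edges**; at the mark–mark edges `ca`, `cb` the step is «free» (§15.2 (ii),
§16.3 (b): `f(G/ca) ≥ I_D · I_A` with ratio `≥ 1`).  Here the free step is proved from Harris:

* **`prob_update_zero_le_prob_update_one_of`** — transfer across one edge: if every configuration
  of `X` with `e` closed lands in `Y` once `e` is opened, `P_{p[e:=0]}(X) ≤ P_{p[e:=1]}(Y)`;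
* **`law3_swap`**, `slack26_swap`, `Con26_swap` — the `a ↔ b` symmetry of the rows, of the slack
  and of (Con);
* **`Con26_of_joins`** — the free step: if `e` joins `c` and `a` (both orientations), then
  `Con26 p e a b c` for every `p ∈ [0,1]^E`: under `p[e:=1]` the rows `y₁, z` are null and
  `I_D = P_{p[e:=0]}(c ≁ a ∧ c ≁ b)`, `I_A ≤ P_{p[e:=0]}(a ≁ b)`, so by Harris for the two
  decreasing events and the transfer of `{c ≁ a, c ≁ b, a ≁ b}` into the row `ac|b`,
  `I_D · I_A ≤ P_{p[e:=0]}(c ≁ {a,b}, a ≁ b) ≤ y₂(p[e:=1]) ≤ f(p[e:=1])`;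
  **`Con26_of_markEdge`** covers `cb` by the symmetry;
* **`Con26_of_eq`** — with `c ∈ {a, b}` the condition is trivial (`I_D = 0`, `f ≥ 0`);
* **`ConCNonMarkEdges`** — mine-3's (Con)_cv exactly as censused (non-loop edges at `c` not
  incident to `a` or `b`, a `def`) and **`slack26_nonneg_of_conCNonMarkEdges`** /
  **`c026_rows_of_conCNonMarkEdges`**: it implies C-026 for every multigraph, `p` and marks.
-/

namespace PercRepro

open Finset

/-! ### Transfer across one edge -/

/-- **Transfer across one edge**: if every configuration of `X` with `e` closed lies in `Y` after
`e` is opened, then `P_{p[e:=0]}(X) ≤ P_{p[e:=1]}(Y)` (the weight of the other edges is the same). -/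
theorem prob_update_zero_le_prob_update_one_of {E : Type*} [Fintype E] [DecidableEq E]
    {p : E → ℝ} (hp : IsProb p) (e : E) {X Y : Set (Config E)}
    (h : ∀ ω : Config E, ω e = false → ω ∈ X → Function.update ω e true ∈ Y) :
    prob (Function.update p e 0) X ≤ prob (Function.update p e 1) Y := by
  unfold prob
  simp only [indicator_weight_update_zero, indicator_weight_update_one]
  rw [← (flipEdge_involutive e).bijective.sum_comp]
  refine Finset.sum_le_sum fun ω _ => ?_
  rw [← Set.indicator_comp_right (flipEdge e)]
  have hcomp : weightErase p e ∘ flipEdge e = weightErase p e := funext (weightErase_flipEdge p e)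
  rw [hcomp]
  refine Set.indicator_le_indicator_of_subset ?_ (fun ω => weightErase_nonneg hp e ω) ω
  intro ω' hω'
  obtain ⟨h1, h2⟩ := hω'
  have h2' : flipEdge e ω' e = false := h2
  have he : ω' e = true := by simpa using h2'
  refine ⟨?_, he⟩
  have hY := h (flipEdge e ω') h2' h1
  have heq : Function.update (flipEdge e ω') e true = ω' := by
    funext e'
    by_cases hee : e' = e
    · subst hee
      simp [he]
    · simp [Function.update_of_ne hee, flipEdge_apply_of_ne hee]
  rwa [heq] at hY

namespace MultiGraph

variable {V E : Type*} (G : MultiGraph V E) [Fintype E] [DecidableEq E]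

/-! ### The `a ↔ b` symmetry of the rows -/

/-- The rows of `(b, a, c)` are those of `(a, b, c)` with `y₂ ↔ y₃` swapped. -/
theorem law3_swap (p : E → ℝ) (a b c : V) :
    G.law3 p b a c 0 = G.law3 p a b c 0 ∧ G.law3 p b a c 1 = G.law3 p a b c 1 ∧
      G.law3 p b a c 2 = G.law3 p a b c 3 ∧ G.law3 p b a c 3 = G.law3 p a b c 2 ∧
        G.law3 p b a c 4 = G.law3 p a b c 4 := by
  refine ⟨?_, ?_, ?_, ?_, ?_⟩
  · rw [law3_zero, law3_zero, G.partitionEvent_row_abc, G.partitionEvent_row_abc]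
    congr 1
    ext ω
    obtain ⟨h1, h2, h3⟩ := G.conn_three_trans a b c (ω := ω)
    simp only [Set.mem_inter_iff, mem_connEvent, G.conn_comm (u := b) (v := a)]
    tauto
  · rw [law3_one, law3_one, G.partitionEvent_row_ab_c, G.partitionEvent_row_ab_c]
    congr 1
    ext ω
    obtain ⟨h1, h2, h3⟩ := G.conn_three_trans a b c (ω := ω)
    simp only [Set.mem_inter_iff, mem_connEvent, mem_sepEvent, G.conn_comm (u := b) (v := a)]
    tauto
  · rw [law3_two, law3_three, G.partitionEvent_row_ac_b, G.partitionEvent_row_bc_a]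
    congr 1
    ext ω
    simp only [Set.mem_inter_iff, mem_connEvent, mem_sepEvent, G.conn_comm (u := b) (v := a)]
  · rw [law3_three, law3_two, G.partitionEvent_row_bc_a, G.partitionEvent_row_ac_b]
    congr 1
    ext ω
    simp only [Set.mem_inter_iff, mem_connEvent, mem_sepEvent, G.conn_comm (u := b) (v := a)]
  · rw [law3_four, law3_four, G.partitionEvent_row_a_b_c, G.partitionEvent_row_a_b_c]
    congr 1
    ext ω
    simp only [Set.mem_inter_iff, mem_sepEvent, G.conn_comm (u := b) (v := a)]
    tauto

/-- The C-026 slack is symmetric in `a, b`. -/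
theorem slack26_swap (p : E → ℝ) (a b c : V) : G.slack26 p b a c = G.slack26 p a b c := by
  obtain ⟨h0, h1, h2, h3, h4⟩ := G.law3_swap p a b c
  unfold slack26
  rw [h0, h1, h2, h3, h4]
  ring

/-- `I_A` is symmetric in `a, b`. -/
theorem pivA26_swap (p : E → ℝ) (e : E) (a b c : V) :
    G.pivA26 p e b a c = G.pivA26 p e a b c := by
  obtain ⟨h0, h1, -, -, -⟩ := G.law3_swap (Function.update p e 1) a b c
  obtain ⟨h0', h1', -, -, -⟩ := G.law3_swap (Function.update p e 0) a b c
  unfold pivA26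
  rw [h0, h1, h0', h1']

/-- `I_D` is symmetric in `a, b`. -/
theorem pivD26_swap (p : E → ℝ) (e : E) (a b c : V) :
    G.pivD26 p e b a c = G.pivD26 p e a b c := by
  obtain ⟨-, h1, -, -, h4⟩ := G.law3_swap (Function.update p e 1) a b c
  obtain ⟨-, h1', -, -, h4'⟩ := G.law3_swap (Function.update p e 0) a b c
  unfold pivD26
  rw [h1, h4, h1', h4']

/-- (Con) is symmetric in `a, b`. -/
theorem Con26_swap (p : E → ℝ) (e : E) (a b c : V) :
    G.Con26 p e b a c ↔ G.Con26 p e a b c := by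
  unfold Con26
  rw [G.slack26_swap, G.pivA26_swap, G.pivD26_swap]

/-! ### Null rows when `e` joins `c` to a mark -/

/-- If every open `e` joins `c` and `a`, the event `a ≁ c` is null under `p[e:=1]`. -/
theorem prob_update_one_sepEvent_eq_zero {p : E → ℝ} {e : E} {a c : V}
    (hjoin : ∀ ω : Config E, ω e = true → G.Conn ω c a) :
    prob (Function.update p e 1) (G.sepEvent a c) = 0 := by
  refine prob_eq_zero_of_forall_weight_eq_zero _ fun ω hω => ?_
  cases he : ω e
  · exact weight_eq_zero_of_closed_of_eq_one (by simp) he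
  · exact absurd (hjoin ω he).symm hω

/-! ### The free step -/

/-- **The free step** (mine-3 §15.2 (ii)): if the edge `e` joins `c` and `a` — every open `e`
connects them, and opening `e` creates only connections through `c`–`a` — then (Con)_e holds at
every `p ∈ [0,1]^E`. -/
theorem Con26_of_joins {p : E → ℝ} (hp : IsProb p) {e : E} {a b c : V}
    (hjoin : ∀ ω : Config E, ω e = true → G.Conn ω c a)
    (hopen : ∀ (ω : Config E) (u v : V), G.Conn (Function.update ω e true) u v →
      G.Conn ω u v ∨ (G.Conn ω u c ∧ G.Conn ω a v) ∨ (G.Conn ω u a ∧ G.Conn ω c v)) :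
    G.Con26 p e a b c := by
  set p₀ := Function.update p e 0 with hp₀
  set p₁ := Function.update p e 1 with hp₁
  have hp0 : IsProb p₀ := hp.update e ⟨le_rfl, zero_le_one⟩
  have hp1 : IsProb p₁ := hp.update e ⟨zero_le_one, le_rfl⟩
  -- the separation `a ≁ c` is null under `p₁`
  have hnull : prob p₁ (G.sepEvent a c) = 0 := G.prob_update_one_sepEvent_eq_zero hjoin
  -- hence `I_D = P_{p₀}(c ≁ a ∧ c ≁ b)`
  have hS1 : prob p₁ (G.sepEvent a c ∩ G.sepEvent b c) = 0 :=
    le_antisymm (hnull ▸ prob_inter_le_left hp1 _ _) (prob_nonneg hp1 _)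
  have hD : G.pivD26 p e a b c = prob p₀ (G.sepEvent a c ∩ G.sepEvent b c) := by
    rw [pivD26_eq, ← hp₀, ← hp₁, hS1, sub_zero]
  -- and `I_A ≤ P_{p₀}(a ≁ b)`
  have hA : G.pivA26 p e a b c ≤ prob p₀ (G.sepEvent a b) := by
    rw [pivA26_eq, ← hp₀, ← hp₁]
    have := prob_le_one hp1 (G.connEvent a b)
    have h2 := prob_compl p₀ (G.connEvent a b)
    unfold sepEvent
    linarith
  -- the rows `y₁, z` of `p₁` are null, so `f(p₁) ≥ y₂(p₁)`
  have hy1 : G.law3 p₁ a b c 1 = 0 := by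
    refine le_antisymm ?_ (prob_nonneg hp1 _)
    rw [law3_one, G.partitionEvent_row_ab_c, ← hnull]
    exact prob_inter_le_right hp1 _ _
  have hz : G.law3 p₁ a b c 4 = 0 := by
    refine le_antisymm ?_ (prob_nonneg hp1 _)
    rw [law3_four, G.partitionEvent_row_a_b_c, ← hnull]
    exact le_trans (prob_inter_le_left hp1 _ _) (prob_inter_le_right hp1 _ _)
  have hy3 : 0 ≤ G.law3 p₁ a b c 3 := prob_nonneg hp1 _
  have hf : G.law3 p₁ a b c 2 ≤ G.slack26 p₁ a b c := by
    unfold slack26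
    rw [hy1, hz]
    nlinarith
  -- transfer: `{c ≁ a, c ≁ b, a ≁ b}` with `e` closed lands in the row `ac|b` once `e` is open
  have htr : prob p₀ (G.sepEvent a c ∩ G.sepEvent b c ∩ G.sepEvent a b) ≤
      G.law3 p₁ a b c 2 := by
    rw [law3_two, G.partitionEvent_row_ac_b]
    refine prob_update_zero_le_prob_update_one_of hp e fun ω he hω => ?_
    obtain ⟨⟨hac, hbc⟩, hab⟩ := hω
    refine ⟨(hjoin _ (by simp)).symm, fun h => ?_⟩
    rcases hopen ω a b h with h | ⟨h1, h2⟩ | ⟨-, h2⟩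
    · exact hab h
    · exact hab h2
    · exact hbc h2.symm
  -- Harris for the two decreasing events
  have hharris := harris_lower hp0
    ((G.isLowerSet_sepEvent a c).inter (G.isLowerSet_sepEvent b c)) (G.isLowerSet_sepEvent a b)
  have hS0 : 0 ≤ prob p₀ (G.sepEvent a c ∩ G.sepEvent b c) := prob_nonneg hp0 _
  unfold Con26
  rw [← hp₁, hD]
  calc prob p₀ (G.sepEvent a c ∩ G.sepEvent b c) * G.pivA26 p e a b c
      ≤ prob p₀ (G.sepEvent a c ∩ G.sepEvent b c) * prob p₀ (G.sepEvent a b) :=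
        mul_le_mul_of_nonneg_left hA hS0
    _ ≤ prob p₀ (G.sepEvent a c ∩ G.sepEvent b c ∩ G.sepEvent a b) := hharris
    _ ≤ G.law3 p₁ a b c 2 := htr
    _ ≤ G.slack26 p₁ a b c := hf

omit [Fintype E] in
/-- The two hypotheses of `Con26_of_joins` hold when `{fst e, snd e} = {c, a}`. -/
theorem joins_of_ends {e : E} {a c : V} (h : (G.fst e = c ∧ G.snd e = a) ∨ (G.fst e = a ∧ G.snd e = c)) :
    (∀ ω : Config E, ω e = true → G.Conn ω c a) ∧
      ∀ (ω : Config E) (u v : V), G.Conn (Function.update ω e true) u v →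
        G.Conn ω u v ∨ (G.Conn ω u c ∧ G.Conn ω a v) ∨ (G.Conn ω u a ∧ G.Conn ω c v) := by
  refine ⟨fun ω he => ?_, fun ω u v huv => ?_⟩
  · have := G.openAdj_of_open e he
    rcases h with ⟨h1, h2⟩ | ⟨h1, h2⟩
    · rw [h1, h2] at this
      exact Conn.of_openAdj this
    · rw [h1, h2] at this
      exact (Conn.of_openAdj this).symm
  · rw [G.conn_update_true_iff] at huv
    rcases h with ⟨h1, h2⟩ | ⟨h1, h2⟩
    · rw [h1, h2] at huv
      exact huv
    · rw [h1, h2] at huv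
      rcases huv with h | ⟨h3, h4⟩ | ⟨h3, h4⟩
      · exact Or.inl h
      · exact Or.inr (Or.inr ⟨h3, h4⟩)
      · exact Or.inr (Or.inl ⟨h3, h4⟩)

/-- **(Con) is free at every mark–mark edge at `c`**: an edge joining `c` to `a` or to `b`. -/
theorem Con26_of_markEdge {p : E → ℝ} (hp : IsProb p) {e : E} {a b c : V}
    (h : (G.fst e = c ∧ G.snd e = a) ∨ (G.fst e = a ∧ G.snd e = c) ∨
      (G.fst e = c ∧ G.snd e = b) ∨ (G.fst e = b ∧ G.snd e = c)) :
    G.Con26 p e a b c := by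
  rcases h with h | h | h | h
  · obtain ⟨h1, h2⟩ := G.joins_of_ends (Or.inl h)
    exact G.Con26_of_joins hp h1 h2
  · obtain ⟨h1, h2⟩ := G.joins_of_ends (Or.inr h)
    exact G.Con26_of_joins hp h1 h2
  · obtain ⟨h1, h2⟩ := G.joins_of_ends (a := b) (Or.inl h)
    exact (G.Con26_swap p e a b c).1 (G.Con26_of_joins hp h1 h2)
  · obtain ⟨h1, h2⟩ := G.joins_of_ends (a := b) (Or.inr h)
    exact (G.Con26_swap p e a b c).1 (G.Con26_of_joins hp h1 h2)

/-- **Repeated marks**: with `c ∈ {a, b}` the rows `y₁, z` vanish, so `f = y₂ + y₃ ≥ 0`. -/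
theorem slack26_nonneg_of_eq {p : E → ℝ} (hp : IsProb p) {a b c : V} (h : c = a ∨ c = b) :
    0 ≤ G.slack26 p a b c := by
  have hy2 : 0 ≤ G.law3 p a b c 2 := prob_nonneg hp _
  have hy3 : 0 ≤ G.law3 p a b c 3 := prob_nonneg hp _
  have h1 : G.law3 p a b c 1 = 0 := by
    rw [law3_one, G.partitionEvent_row_ab_c, ← prob_empty p]
    congr 1
    ext ω
    simp only [Set.mem_inter_iff, mem_connEvent, mem_sepEvent, Set.mem_empty_iff_false,
      iff_false]
    rcases h with rfl | rfl
    · exact fun h => h.2 (Conn.refl G ω c)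
    · exact fun h => h.2 h.1
  have h4 : G.law3 p a b c 4 = 0 := by
    rw [law3_four, G.partitionEvent_row_a_b_c, ← prob_empty p]
    congr 1
    ext ω
    simp only [Set.mem_inter_iff, mem_sepEvent, Set.mem_empty_iff_false, iff_false]
    rcases h with rfl | rfl
    · exact fun h => h.1.2 (Conn.refl G ω c)
    · exact fun h => h.2 (Conn.refl G ω c)
  unfold slack26
  rw [h1, h4]
  nlinarith

/-- **Repeated marks**: with `c ∈ {a, b}`, `I_D = 0` and `f ≥ 0`, so (Con)_e holds trivially. -/
theorem Con26_of_eq {p : E → ℝ} (hp : IsProb p) (e : E) {a b c : V} (h : c = a ∨ c = b) :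
    G.Con26 p e a b c := by
  have hp1 : IsProb (Function.update p e 1) := hp.update e ⟨zero_le_one, le_rfl⟩
  have hempty : G.sepEvent a c ∩ G.sepEvent b c = ∅ := by
    ext ω
    simp only [Set.mem_inter_iff, mem_sepEvent, Set.mem_empty_iff_false, iff_false]
    rcases h with rfl | rfl
    · exact fun h => h.1 (Conn.refl G ω c)
    · exact fun h => h.2 (Conn.refl G ω c)
  have hD : G.pivD26 p e a b c = 0 := by
    rw [pivD26_eq, hempty, prob_empty, prob_empty, sub_zero]
  unfold Con26
  rw [hD, zero_mul]
  exact G.slack26_nonneg_of_eq hp1 h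

end MultiGraph

/-! ### The bridge from the censused form -/

/-- **(Con) at every c–non-mark edge** — mine-3's (Con)_cv exactly as censused (§16.3): for every
finite multigraph, every `p ∈ [0,1]^E`, every marks `a, b, c` and every non-loop edge `e` at `c`
incident to neither `a` nor `b`, `f(p[e:=1]) ≥ I_D · I_A`.  A statement (`def`), never assumed
silently. -/
def ConCNonMarkEdges : Prop :=
  ∀ {V E : Type} [Fintype E] [DecidableEq E] (G : MultiGraph V E) (p : E → ℝ), IsProb p →
    ∀ a b c : V, ∀ e : E, G.IsCEdge c e →
      G.fst e ≠ a → G.snd e ≠ a → G.fst e ≠ b → G.snd e ≠ b → G.Con26 p e a b c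

/-- **The censused form implies the full form**: at the mark–mark edges at `c` the step is free
(`Con26_of_markEdge`), and with `c ∈ {a, b}` it is trivial (`Con26_of_eq`). -/
theorem ConCEdges_of_conCNonMarkEdges (h : ConCNonMarkEdges) : ConCEdges := by
  intro V E _ _ G p hp a b c e he
  by_cases hca : c = a
  · exact G.Con26_of_eq hp e (Or.inl hca)
  by_cases hcb : c = b
  · exact G.Con26_of_eq hp e (Or.inr hcb)
  by_cases hfa : G.fst e = a
  · rcases he.1 with h1 | h1
    · exact absurd (h1.symm.trans hfa) hca
    · exact G.Con26_of_markEdge hp (Or.inr (Or.inl ⟨hfa, h1⟩))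
  by_cases hsa : G.snd e = a
  · rcases he.1 with h1 | h1
    · exact G.Con26_of_markEdge hp (Or.inl ⟨h1, hsa⟩)
    · exact absurd (h1.symm.trans hsa) hca
  by_cases hfb : G.fst e = b
  · rcases he.1 with h1 | h1
    · exact absurd (h1.symm.trans hfb) hcb
    · exact G.Con26_of_markEdge hp (Or.inr (Or.inr (Or.inr ⟨hfb, h1⟩)))
  by_cases hsb : G.snd e = b
  · rcases he.1 with h1 | h1
    · exact G.Con26_of_markEdge hp (Or.inr (Or.inr (Or.inl ⟨h1, hsb⟩)))
    · exact absurd (h1.symm.trans hsb) hcb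
  exact h G p hp a b c e he hfa hsa hfb hsb

/-- **The bridge of record in the censused form**: (Con) at every c–non-mark edge of every marked
multigraph gives C-026 (`0 ≤ slack26`) for every multigraph, every `p ∈ [0,1]^E`, every marks. -/
theorem slack26_nonneg_of_conCNonMarkEdges (h : ConCNonMarkEdges) :
    ∀ {V E : Type} [Fintype E] [DecidableEq E] (G : MultiGraph V E) (p : E → ℝ), IsProb p →
      ∀ a b c : V, 0 ≤ G.slack26 p a b c :=
  slack26_nonneg_of_conCEdges (ConCEdges_of_conCNonMarkEdges h)

/-- The same in the rows of `law3` (the literal shape of `C026`). -/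
theorem c026_rows_of_conCNonMarkEdges (h : ConCNonMarkEdges) :
    ∀ {V E : Type} [Fintype E] [DecidableEq E] (G : MultiGraph V E) (p : E → ℝ), IsProb p →
      ∀ a b c : V,
        (G.law3 p a b c 0 + G.law3 p a b c 1) * (G.law3 p a b c 1 + G.law3 p a b c 4) ≤
          G.law3 p a b c 1 + G.law3 p a b c 2 + G.law3 p a b c 3 :=
  c026_rows_of_conCEdges (ConCEdges_of_conCNonMarkEdges h)

end PercRepro
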